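import Literature.Probability.Percolation.VoronoiWeakStrictArms
import Literature.Probability.Percolation.VoronoiFKG
import Literature.Probability.Percolation.VoronoiSymmetry
import Literature.Probability.Percolation.ContinuumCrossingMeasurability
import Literature.Topology.PlaneTopology.PlusCrossing
import HarnessLib

/-!
# Weak continuum crossings for two-colour Poisson–Voronoi percolation: events, FKG, symmetry,
# duality, and the blocking step of the one-arm estimate

Topic `Probability/Percolation`; everything is proved, no named fact is introduced.  This is the
layer between the multi-scale / surgery files (`VoronoiArmEstimatesProofs`, `VoronoiWeakStrictArms`:
`VoronoiAnnealedOneArm_of_annulusBound`) and the Russo–Seymour–Welsh theory of V. Tassion,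
*Crossing probabilities for Voronoi percolation*, Ann. Probab. 44 (2016) [Tassion2016], which is run
(as in Schramm–Smirnov, Ann. Probab. 39 (2011), §1.3) for CONTINUUM crossings: a crossing of a
closed rectangle `R` between closed sets `A, A'` is a compact connected set of WEAKLY black points
(`blackRegion B W`: at least as close to a black nucleus as to a white one, ties both colours,
Tassion §1.1) inside `R` meeting `A` and `A'`.

* `blackCross R A A'`, `whiteCross R A A'` — the crossing events on `PointConfig ℂ × PointConfig ℂ`;
  measurable for compact `R` and closed `A, A'` (`measurableSet_blackCross`: hitting events of compact
  sets by the random closed set `blackRegion` are measurable, then `measurableSet_exists_continuum`).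
* monotonicity: crossing events are black-increasing among configurations with nonempty nucleus sets
  (`IsGoodIncreasing`; the junk value `infDist _ ∅ = 0` spoils monotonicity at the empty
  configuration only), and the regularisation `regInc` makes them honestly black-increasing without
  changing probabilities, whence **FKG** for such events (`measure_mul_le_of_isGoodIncreasing`,
  finite-intersection forms) from `measure_mul_le_of_isBlackIncreasing` (Tassion Prop. 1.2).
* symmetry: `preimage_pairImage_blackCross` (isometries transport crossing events), translation /
  linear-isometry / colour-swap invariance of their probabilities (Tassion, Remark 2 and §4).
* rectangles `cRect a b c d = [a, b] × [c, d]`, left–right and top–bottom crossings `lrCross`,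
  `tbCross` (black) and `lrCrossW`, `tbCrossW` (white); **duality** `mem_lrCross_or_mem_tbCrossW`
  (every configuration has a weak-black left–right or a weak-white top–bottom continuum crossing:
  the dual path `exists_path_avoiding_of_not_crossed` runs through strictly white points) and the
  square bound `P[lrCross of a square] ≥ 1/2` (Tassion eq. (5) with `c₀ = 1/2` at `p = 1/2`).
* **blocking**: weak-white long crossings of the four rectangles of the box annulus
  `A^box(5u/4, 5u/2)` around `z` exclude the strict annulus crossing `strictAnnulusCrossing z u`
  (`not_mem_strictAnnulusCrossing_of_whiteCrossings`, via the plus-position crossing lemma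
  `inter_nonempty_of_plus`), so the scale-uniform hypothesis `hann` of
  `VoronoiAnnealedOneArm_of_annulusBound` follows from a scale-uniform lower bound on the probability
  of weak-black long crossings of `4:1` rectangles (`VoronoiAnnealedOneArm_of_weakRSW`), i.e. from
  Tassion's Theorem 1 (`ρ = 4`) for this model.

## References

* V. Tassion, Ann. Probab. 44 (2016) 3385–3398, §§1.1–1.2, §4. [Tassion2016]
* O. Schramm, S. Smirnov, Ann. Probab. 39 (2011), §1.3. [SchrammSmirnov2011]
* B. Bollobás, O. Riordan, *Percolation* (2006), Ch. 8. [BollobasRiordan2006]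
-/

noncomputable section

namespace Literature.Probability.Percolation

open _root_.MeasureTheory _root_.ProbabilityTheory _root_.Filter _root_.Set _root_.Metric Complex
open scoped _root_.Topology _root_.ENNReal _root_.NNReal
open Literature.Analysis.FunctionSpaces
open Literature.Topology.PlaneTopology

/-- The configuration-pair space of two-coloured nuclei. -/
local notation "Ω₂" => PointConfig ℂ × PointConfig ℂ

/-- The strictly black region of a pair of configurations (black nuclei `ω.1`, white `ω.2`). -/
local notation "𝐒" ω => strictBlackRegion ((Prod.fst ω : PointConfig ℂ) : Set ℂ)
  ((Prod.snd ω : PointConfig ℂ) : Set ℂ)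

/-! ### Weak continuum crossing events -/

section Events

/-- **Weak-black continuum crossing** of `R` from `A` to `A'`: a compact connected set of weakly
black points inside `R` meeting `A` and `A'` (Schramm–Smirnov's crossings, Tassion's black paths
with ties counted black). [cite: Tassion2016, §1.1] -/
def blackCross (R A A' : Set ℂ) : Set Ω₂ :=
  {ω | ∃ C ⊆ blackRegion ((ω.1 : PointConfig ℂ) : Set ℂ) ((ω.2 : PointConfig ℂ) : Set ℂ) ∩ R,
    IsCompact C ∧ IsPreconnected C ∧ (C ∩ A).Nonempty ∧ (C ∩ A').Nonempty}

/-- **Weak-white continuum crossing** of `R` from `A` to `A'`. [cite: Tassion2016, §1.1] -/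
def whiteCross (R A A' : Set ℂ) : Set Ω₂ :=
  {ω | ∃ C ⊆ blackRegion ((ω.2 : PointConfig ℂ) : Set ℂ) ((ω.1 : PointConfig ℂ) : Set ℂ) ∩ R,
    IsCompact C ∧ IsPreconnected C ∧ (C ∩ A).Nonempty ∧ (C ∩ A').Nonempty}

variable {R R₁ A A₁ A' A₁' : Set ℂ}

/-- Colour swap turns black crossings into white ones. [folklore] -/
@[simp] theorem preimage_swap_blackCross (R A A' : Set ℂ) :
    Prod.swap ⁻¹' blackCross R A A' = whiteCross R A A' := rfl

/-- Colour swap turns white crossings into black ones. [folklore] -/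
@[simp] theorem preimage_swap_whiteCross (R A A' : Set ℂ) :
    Prod.swap ⁻¹' whiteCross R A A' = blackCross R A A' := rfl

/-- Crossing events are symmetric in the two targets. [folklore] -/
theorem blackCross_comm (R A A' : Set ℂ) : blackCross R A A' = blackCross R A' A := by
  ext ω
  exact exists_congr fun C => by tauto

/-- Crossing events are symmetric in the two targets. [folklore] -/
theorem whiteCross_comm (R A A' : Set ℂ) : whiteCross R A A' = whiteCross R A' A := by
  ext ω
  exact exists_congr fun C => by tauto

/-- Monotonicity of crossing events in the rectangle and the targets. [folklore] -/
theorem blackCross_mono (hR : R ⊆ R₁) (hA : A ⊆ A₁) (hA' : A' ⊆ A₁') :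
    blackCross R A A' ⊆ blackCross R₁ A₁ A₁' := by
  rintro ω ⟨C, hC, hCc, hCp, hCA, hCA'⟩
  exact ⟨C, hC.trans (inter_subset_inter_right _ hR), hCc, hCp, hCA.mono (inter_subset_inter_right _ hA),
    hCA'.mono (inter_subset_inter_right _ hA')⟩

/-- Monotonicity of crossing events in the rectangle and the targets. [folklore] -/
theorem whiteCross_mono (hR : R ⊆ R₁) (hA : A ⊆ A₁) (hA' : A' ⊆ A₁') :
    whiteCross R A A' ⊆ whiteCross R₁ A₁ A₁' := by
  rintro ω ⟨C, hC, hCc, hCp, hCA, hCA'⟩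
  exact ⟨C, hC.trans (inter_subset_inter_right _ hR), hCc, hCp, hCA.mono (inter_subset_inter_right _ hA),
    hCA'.mono (inter_subset_inter_right _ hA')⟩

end Events

/-! ### Measurability -/

section Measurability

/-- **Hitting events of compact sets by the black region are measurable**: the complement is
"`infDist w W < infDist w B` for all `w ∈ Q`", a uniformly Lipschitz family
(`measurableSet_forall_mem_lt`). [folklore] -/
theorem measurableSet_blackRegion_inter_nonempty {Q : Set ℂ} (hQ : IsCompact Q) :
    MeasurableSet {ω : Ω₂ | (blackRegion ((ω.1 : PointConfig ℂ) : Set ℂ)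
      ((ω.2 : PointConfig ℂ) : Set ℂ) ∩ Q).Nonempty} := by
  have h := measurableSet_forall_mem_lt (α := Ω₂) (K := 1 + 1) (Q := Q)
    (h := fun ω w => infDist w ((ω.2 : PointConfig ℂ) : Set ℂ) - infDist w ((ω.1 : PointConfig ℂ) : Set ℂ))
    (fun ω => (lipschitz_infDist_pt _).sub (lipschitz_infDist_pt _))
    (fun w => ((PointConfig.measurable_infDist_coe w).comp measurable_snd).sub
      ((PointConfig.measurable_infDist_coe w).comp measurable_fst)) hQ
  have hset : {ω : Ω₂ | (blackRegion ((ω.1 : PointConfig ℂ) : Set ℂ)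
      ((ω.2 : PointConfig ℂ) : Set ℂ) ∩ Q).Nonempty} =
      {ω : Ω₂ | ∀ w ∈ Q, infDist w ((ω.2 : PointConfig ℂ) : Set ℂ) -
        infDist w ((ω.1 : PointConfig ℂ) : Set ℂ) < 0}ᶜ := by
    ext ω
    simp only [mem_setOf_eq, mem_compl_iff, not_forall, not_lt, sub_nonneg, exists_prop]
    constructor
    · rintro ⟨w, hwb, hwQ⟩
      exact ⟨w, hwQ, hwb⟩
    · rintro ⟨w, hwQ, hwb⟩
      exact ⟨w, hwb, hwQ⟩
  rw [hset]
  exact h.compl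

/-- **Weak-black continuum crossing events are measurable** (compact `R`, closed `A, A'`).
[cite: SchrammSmirnov2011, §1.3] -/
theorem measurableSet_blackCross {R A A' : Set ℂ} (hR : IsCompact R) (hA : IsClosed A)
    (hA' : IsClosed A') : MeasurableSet (blackCross R A A') :=
  measurableSet_exists_continuum (α := Ω₂)
    (K := fun ω : Ω₂ => blackRegion ((ω.1 : PointConfig ℂ) : Set ℂ) ((ω.2 : PointConfig ℂ) : Set ℂ))
    (fun _ => isClosed_blackRegion _ _) (fun _ hQ => measurableSet_blackRegion_inter_nonempty hQ)
    hR hA hA'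

/-- Weak-white continuum crossing events are measurable. [cite: SchrammSmirnov2011, §1.3] -/
theorem measurableSet_whiteCross {R A A' : Set ℂ} (hR : IsCompact R) (hA : IsClosed A)
    (hA' : IsClosed A') : MeasurableSet (whiteCross R A A') := by
  rw [← preimage_swap_blackCross]
  exact measurable_swap (measurableSet_blackCross hR hA hA')

/-- "The black nuclei are nonempty" is measurable. [folklore] -/
theorem measurableSet_fst_coe_nonempty :
    MeasurableSet {ω : Ω₂ | ((ω.1 : PointConfig ℂ) : Set ℂ).Nonempty} := by
  have hset : {ω : Ω₂ | ((ω.1 : PointConfig ℂ) : Set ℂ).Nonempty} =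
      (fun ω : Ω₂ => (ω.1 : PointConfig ℂ).count univ) ⁻¹' {x | x ≠ 0} := by
    ext ω
    simp only [mem_setOf_eq, mem_preimage]
    rw [PointConfig.count_ne_zero_iff, inter_univ, PointConfig.coe_eq_carrier]
  rw [hset]
  exact ((PointConfig.measurable_count MeasurableSet.univ).comp measurable_fst)
    (MeasurableSpace.measurableSet_top : MeasurableSet {x : ℕ∞ | x ≠ 0})

/-- "The white nuclei are nonempty" is measurable. [folklore] -/
theorem measurableSet_snd_coe_nonempty :
    MeasurableSet {ω : Ω₂ | ((ω.2 : PointConfig ℂ) : Set ℂ).Nonempty} := by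
  have hset : {ω : Ω₂ | ((ω.2 : PointConfig ℂ) : Set ℂ).Nonempty} =
      (fun ω : Ω₂ => (ω.2 : PointConfig ℂ).count univ) ⁻¹' {x | x ≠ 0} := by
    ext ω
    simp only [mem_setOf_eq, mem_preimage]
    rw [PointConfig.count_ne_zero_iff, inter_univ, PointConfig.coe_eq_carrier]
  rw [hset]
  exact ((PointConfig.measurable_count MeasurableSet.univ).comp measurable_snd)
    (MeasurableSpace.measurableSet_top : MeasurableSet {x : ℕ∞ | x ≠ 0})

/-- "The black nuclei are empty" is measurable. [folklore] -/
theorem measurableSet_fst_coe_eq_empty :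
    MeasurableSet {ω : Ω₂ | ((ω.1 : PointConfig ℂ) : Set ℂ) = ∅} := by
  have : {ω : Ω₂ | ((ω.1 : PointConfig ℂ) : Set ℂ) = ∅} =
      {ω : Ω₂ | ((ω.1 : PointConfig ℂ) : Set ℂ).Nonempty}ᶜ := by
    ext ω; simp [not_nonempty_iff_eq_empty]
  rw [this]
  exact measurableSet_fst_coe_nonempty.compl

/-- "The white nuclei are empty" is measurable. [folklore] -/
theorem measurableSet_snd_coe_eq_empty :
    MeasurableSet {ω : Ω₂ | ((ω.2 : PointConfig ℂ) : Set ℂ) = ∅} := by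
  have : {ω : Ω₂ | ((ω.2 : PointConfig ℂ) : Set ℂ) = ∅} =
      {ω : Ω₂ | ((ω.2 : PointConfig ℂ) : Set ℂ).Nonempty}ᶜ := by
    ext ω; simp [not_nonempty_iff_eq_empty]
  rw [this]
  exact measurableSet_snd_coe_nonempty.compl

end Measurability

/-! ### Monotonicity on good configurations, regularisation, FKG -/

section Monotone

/-- An event is **good-increasing** if it is black-increasing among configurations whose nucleus
sets involved in the comparison are nonempty (the only configurations where the junk value
`infDist _ ∅ = 0` interferes with the monotonicity of `blackRegion`). [cite: Tassion2016, §1.2] -/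
def IsGoodIncreasing (A : Set Ω₂) : Prop :=
  ∀ ⦃ω ω' : Ω₂⦄, ω ∈ A → ((ω.1 : PointConfig ℂ) : Set ℂ).Nonempty →
    ((ω'.2 : PointConfig ℂ) : Set ℂ).Nonempty → ((ω.1 : PointConfig ℂ) : Set ℂ) ⊆ ω'.1 →
    ((ω'.2 : PointConfig ℂ) : Set ℂ) ⊆ ω.2 → ω' ∈ A

/-- An event is **good-decreasing** (white-increasing on good configurations).
[cite: Tassion2016, §1.2] -/
def IsGoodDecreasing (A : Set Ω₂) : Prop :=
  ∀ ⦃ω ω' : Ω₂⦄, ω ∈ A → ((ω.2 : PointConfig ℂ) : Set ℂ).Nonempty →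
    ((ω'.1 : PointConfig ℂ) : Set ℂ).Nonempty → ((ω'.1 : PointConfig ℂ) : Set ℂ) ⊆ ω.1 →
    ((ω.2 : PointConfig ℂ) : Set ℂ) ⊆ ω'.2 → ω' ∈ A

variable {E F : Set Ω₂}

/-- Weak-black crossing events are good-increasing (`blackRegion_mono`). [cite: Tassion2016, §1.2] -/
theorem isGoodIncreasing_blackCross (R A A' : Set ℂ) : IsGoodIncreasing (blackCross R A A') := by
  rintro ω ω' ⟨C, hC, hCc, hCp, hCA, hCA'⟩ hB hW' h1 h2
  exact ⟨C, hC.trans (inter_subset_inter_left _ (blackRegion_mono h1 hB h2 hW')), hCc, hCp, hCA, hCA'⟩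

/-- Weak-white crossing events are good-decreasing. [cite: Tassion2016, §1.2] -/
theorem isGoodDecreasing_whiteCross (R A A' : Set ℂ) : IsGoodDecreasing (whiteCross R A A') := by
  rintro ω ω' ⟨C, hC, hCc, hCp, hCA, hCA'⟩ hW hB' h1 h2
  exact ⟨C, hC.trans (inter_subset_inter_left _ (blackRegion_mono h2 hW h1 hB')), hCc, hCp, hCA, hCA'⟩

/-- Intersections of good-increasing events are good-increasing. [folklore] -/
theorem IsGoodIncreasing.inter (hE : IsGoodIncreasing E) (hF : IsGoodIncreasing F) :
    IsGoodIncreasing (E ∩ F) :=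
  fun _ _ hω hB hW' h1 h2 => ⟨hE hω.1 hB hW' h1 h2, hF hω.2 hB hW' h1 h2⟩

/-- Intersections of good-decreasing events are good-decreasing. [folklore] -/
theorem IsGoodDecreasing.inter (hE : IsGoodDecreasing E) (hF : IsGoodDecreasing F) :
    IsGoodDecreasing (E ∩ F) :=
  fun _ _ hω hW hB' h1 h2 => ⟨hE hω.1 hW hB' h1 h2, hF hω.2 hW hB' h1 h2⟩

/-- Finite intersections of good-increasing events are good-increasing. [folklore] -/
theorem isGoodIncreasing_biInter {ι : Type*} (s : Finset ι) {Ev : ι → Set Ω₂}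
    (h : ∀ i ∈ s, IsGoodIncreasing (Ev i)) : IsGoodIncreasing (⋂ i ∈ s, Ev i) := by
  intro ω ω' hω hB hW' h1 h2
  simp only [mem_iInter] at hω ⊢
  exact fun i hi => h i hi (hω i hi) hB hW' h1 h2

/-- Finite intersections of good-decreasing events are good-decreasing. [folklore] -/
theorem isGoodDecreasing_biInter {ι : Type*} (s : Finset ι) {Ev : ι → Set Ω₂}
    (h : ∀ i ∈ s, IsGoodDecreasing (Ev i)) : IsGoodDecreasing (⋂ i ∈ s, Ev i) := by
  intro ω ω' hω hW hB' h1 h2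
  simp only [mem_iInter] at hω ⊢
  exact fun i hi => h i hi (hω i hi) hW hB' h1 h2

/-- The colour swap of a good-increasing event is good-decreasing. [folklore] -/
theorem IsGoodIncreasing.preimage_swap (hE : IsGoodIncreasing E) :
    IsGoodDecreasing (Prod.swap ⁻¹' E) :=
  fun _ _ hω hW hB' h1 h2 => hE hω hW hB' h2 h1

/-- The colour swap of a good-decreasing event is good-increasing. [folklore] -/
theorem IsGoodDecreasing.preimage_swap (hE : IsGoodDecreasing E) :
    IsGoodIncreasing (Prod.swap ⁻¹' E) :=
  fun _ _ hω hB hW' h1 h2 => hE hω hB hW' h2 h1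

/-- **Regularisation** of a good-increasing event: intersect with "black nuclei nonempty" and add
"white nuclei empty"; this changes the event on a null set only and makes it black-increasing.
[folklore] -/
def regInc (E : Set Ω₂) : Set Ω₂ :=
  (E ∩ {ω | ((ω.1 : PointConfig ℂ) : Set ℂ).Nonempty}) ∪ {ω | ((ω.2 : PointConfig ℂ) : Set ℂ) = ∅}

/-- **Regularisation** of a good-decreasing event. [folklore] -/
def regDec (E : Set Ω₂) : Set Ω₂ :=
  (E ∩ {ω | ((ω.2 : PointConfig ℂ) : Set ℂ).Nonempty}) ∪ {ω | ((ω.1 : PointConfig ℂ) : Set ℂ) = ∅}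

/-- The regularisation of a good-increasing event is black-increasing. [folklore] -/
theorem IsGoodIncreasing.isBlackIncreasing_regInc (hE : IsGoodIncreasing E) :
    IsBlackIncreasing (regInc E) := by
  intro ω ω' hω h1 h2
  by_cases hW' : ((ω'.2 : PointConfig ℂ) : Set ℂ) = ∅
  · exact Or.inr hW'
  have hW'ne : ((ω'.2 : PointConfig ℂ) : Set ℂ).Nonempty := nonempty_iff_ne_empty.2 hW'
  rcases hω with ⟨hωE, hB⟩ | hW
  · exact Or.inl ⟨hE hωE hB hW'ne h1 h2, hB.mono h1⟩
  · exact absurd (subset_eq_empty h2 hW) hW'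

/-- The regularisation of a good-decreasing event is black-decreasing. [folklore] -/
theorem IsGoodDecreasing.isBlackDecreasing_regDec (hE : IsGoodDecreasing E) :
    IsBlackDecreasing (regDec E) := by
  intro ω ω' hω h1 h2
  by_cases hB' : ((ω'.1 : PointConfig ℂ) : Set ℂ) = ∅
  · exact Or.inr hB'
  have hB'ne : ((ω'.1 : PointConfig ℂ) : Set ℂ).Nonempty := nonempty_iff_ne_empty.2 hB'
  rcases hω with ⟨hωE, hW⟩ | hB
  · exact Or.inl ⟨hE hωE hW hB'ne h1 h2, hW.mono h2⟩
  · exact absurd (subset_eq_empty h1 hB) hB'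

/-- Regularisations of measurable events are measurable. [folklore] -/
theorem measurableSet_regInc (hE : MeasurableSet E) : MeasurableSet (regInc E) :=
  (hE.inter measurableSet_fst_coe_nonempty).union measurableSet_snd_coe_eq_empty

/-- Regularisations of measurable events are measurable. [folklore] -/
theorem measurableSet_regDec (hE : MeasurableSet E) : MeasurableSet (regDec E) :=
  (hE.inter measurableSet_snd_coe_nonempty).union measurableSet_fst_coe_eq_empty

variable {PB PW : Measure (PointConfig ℂ)}

/-- Under `PB ⊗ PW` (Poisson, Lebesgue intensities) both nucleus sets are a.s. nonempty.
[cite: Kingman1993, §2.1] -/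
theorem ae_coe_nonempty (hB : IsPoissonPointProcess (volume : Measure ℂ) PB)
    (hW : IsPoissonPointProcess (volume : Measure ℂ) PW) :
    ∀ᵐ ω ∂(PB.prod PW), ((ω.1 : PointConfig ℂ) : Set ℂ).Nonempty ∧
      ((ω.2 : PointConfig ℂ) : Set ℂ).Nonempty := by
  have h1 : ∀ᵐ ω ∂(PB.prod PW), ((ω.1 : PointConfig ℂ) : Set ℂ).Nonempty := by
    rw [ae_iff]
    simpa only [not_nonempty_iff_eq_empty] using measure_fst_coe_eq_empty hB hW
  have h2 : ∀ᵐ ω ∂(PB.prod PW), ((ω.2 : PointConfig ℂ) : Set ℂ).Nonempty := by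
    rw [ae_iff]
    simpa only [not_nonempty_iff_eq_empty] using measure_snd_coe_eq_empty hB hW
  filter_upwards [h1, h2] with ω h1 h2
  exact ⟨h1, h2⟩

/-- The regularisation does not change the event almost surely. [folklore] -/
theorem regInc_ae_eq (hB : IsPoissonPointProcess (volume : Measure ℂ) PB)
    (hW : IsPoissonPointProcess (volume : Measure ℂ) PW) (E : Set Ω₂) :
    (regInc E : Set Ω₂) =ᵐ[PB.prod PW] E := by
  filter_upwards [ae_coe_nonempty hB hW] with ω hω
  refine propext ?_
  change ω ∈ regInc E ↔ ω ∈ E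
  simp only [regInc, mem_union, mem_inter_iff, mem_setOf_eq, hω.1, hω.2.ne_empty, and_true, or_false]

/-- The regularisation does not change the event almost surely. [folklore] -/
theorem regDec_ae_eq (hB : IsPoissonPointProcess (volume : Measure ℂ) PB)
    (hW : IsPoissonPointProcess (volume : Measure ℂ) PW) (E : Set Ω₂) :
    (regDec E : Set Ω₂) =ᵐ[PB.prod PW] E := by
  filter_upwards [ae_coe_nonempty hB hW] with ω hω
  refine propext ?_
  change ω ∈ regDec E ↔ ω ∈ E
  simp only [regDec, mem_union, mem_inter_iff, mem_setOf_eq, hω.2, hω.1.ne_empty, and_true, or_false]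

/-- **FKG for good-increasing events** (Tassion 2016, Prop. 1.2, in the form needed for weak
continuum crossing events): `P[E] P[F] ≤ P[E ∩ F]`. [cite: Tassion2016, Prop 1.2] -/
theorem measure_mul_le_of_isGoodIncreasing (hB : IsPoissonPointProcess (volume : Measure ℂ) PB)
    (hW : IsPoissonPointProcess (volume : Measure ℂ) PW) (hE : IsGoodIncreasing E)
    (hF : IsGoodIncreasing F) (hEm : MeasurableSet E) (hFm : MeasurableSet F) :
    (PB.prod PW) E * (PB.prod PW) F ≤ (PB.prod PW) (E ∩ F) := by
  have h := measure_mul_le_of_isBlackIncreasing hB hW hE.isBlackIncreasing_regInc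
    hF.isBlackIncreasing_regInc (measurableSet_regInc hEm) (measurableSet_regInc hFm)
  rwa [measure_congr (regInc_ae_eq hB hW E), measure_congr (regInc_ae_eq hB hW F),
    measure_congr ((regInc_ae_eq hB hW E).inter (regInc_ae_eq hB hW F))] at h

/-- **FKG for good-decreasing events**: `P[E] P[F] ≤ P[E ∩ F]`. [cite: Tassion2016, Prop 1.2] -/
theorem measure_mul_le_of_isGoodDecreasing (hB : IsPoissonPointProcess (volume : Measure ℂ) PB)
    (hW : IsPoissonPointProcess (volume : Measure ℂ) PW) (hE : IsGoodDecreasing E)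
    (hF : IsGoodDecreasing F) (hEm : MeasurableSet E) (hFm : MeasurableSet F) :
    (PB.prod PW) E * (PB.prod PW) F ≤ (PB.prod PW) (E ∩ F) := by
  have h := measure_mul_le_of_isBlackDecreasing hB hW hE.isBlackDecreasing_regDec
    hF.isBlackDecreasing_regDec (measurableSet_regDec hEm) (measurableSet_regDec hFm)
  rwa [measure_congr (regDec_ae_eq hB hW E), measure_congr (regDec_ae_eq hB hW F),
    measure_congr ((regDec_ae_eq hB hW E).inter (regDec_ae_eq hB hW F))] at h

/-- Real-valued FKG for good-increasing events. [cite: Tassion2016, Prop 1.2] -/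
theorem measureReal_mul_le_of_isGoodIncreasing (hB : IsPoissonPointProcess (volume : Measure ℂ) PB)
    (hW : IsPoissonPointProcess (volume : Measure ℂ) PW) (hE : IsGoodIncreasing E)
    (hF : IsGoodIncreasing F) (hEm : MeasurableSet E) (hFm : MeasurableSet F) :
    (PB.prod PW).real E * (PB.prod PW).real F ≤ (PB.prod PW).real (E ∩ F) := by
  haveI := hB.isProbabilityMeasure; haveI := hW.isProbabilityMeasure
  rw [measureReal_def, measureReal_def, measureReal_def, ← ENNReal.toReal_mul]
  exact ENNReal.toReal_mono (measure_ne_top _ _)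
    (measure_mul_le_of_isGoodIncreasing hB hW hE hF hEm hFm)

/-- Real-valued FKG for good-decreasing events. [cite: Tassion2016, Prop 1.2] -/
theorem measureReal_mul_le_of_isGoodDecreasing (hB : IsPoissonPointProcess (volume : Measure ℂ) PB)
    (hW : IsPoissonPointProcess (volume : Measure ℂ) PW) (hE : IsGoodDecreasing E)
    (hF : IsGoodDecreasing F) (hEm : MeasurableSet E) (hFm : MeasurableSet F) :
    (PB.prod PW).real E * (PB.prod PW).real F ≤ (PB.prod PW).real (E ∩ F) := by
  haveI := hB.isProbabilityMeasure; haveI := hW.isProbabilityMeasure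
  rw [measureReal_def, measureReal_def, measureReal_def, ← ENNReal.toReal_mul]
  exact ENNReal.toReal_mono (measure_ne_top _ _)
    (measure_mul_le_of_isGoodDecreasing hB hW hE hF hEm hFm)

/-- **FKG for finitely many good-increasing events**: `∏ᵢ P[Eᵢ] ≤ P[⋂ᵢ Eᵢ]`.
[cite: Tassion2016, Prop 1.2] -/
theorem finset_prod_measureReal_le_of_isGoodIncreasing
    (hB : IsPoissonPointProcess (volume : Measure ℂ) PB)
    (hW : IsPoissonPointProcess (volume : Measure ℂ) PW) {ι : Type*} (s : Finset ι)
    {Ev : ι → Set Ω₂} (hEv : ∀ i ∈ s, IsGoodIncreasing (Ev i))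
    (hEm : ∀ i ∈ s, MeasurableSet (Ev i)) :
    ∏ i ∈ s, (PB.prod PW).real (Ev i) ≤ (PB.prod PW).real (⋂ i ∈ s, Ev i) := by
  classical
  haveI := hB.isProbabilityMeasure; haveI := hW.isProbabilityMeasure
  induction s using Finset.induction_on with
  | empty => simp
  | insert j s hj ih =>
    rw [Finset.prod_insert hj, Finset.set_biInter_insert]
    have hEv' : ∀ i ∈ s, IsGoodIncreasing (Ev i) := fun i hi => hEv i (Finset.mem_insert_of_mem hi)
    have hEm' : ∀ i ∈ s, MeasurableSet (Ev i) := fun i hi => hEm i (Finset.mem_insert_of_mem hi)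
    have h2 := measureReal_mul_le_of_isGoodIncreasing hB hW (hEv j (Finset.mem_insert_self _ _))
      (isGoodIncreasing_biInter s hEv') (hEm j (Finset.mem_insert_self _ _))
      (Finset.measurableSet_biInter _ hEm')
    exact (mul_le_mul_of_nonneg_left (ih hEv' hEm') measureReal_nonneg).trans h2

/-- **FKG for finitely many good-decreasing events**: `∏ᵢ P[Eᵢ] ≤ P[⋂ᵢ Eᵢ]`.
[cite: Tassion2016, Prop 1.2] -/
theorem finset_prod_measureReal_le_of_isGoodDecreasing
    (hB : IsPoissonPointProcess (volume : Measure ℂ) PB)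
    (hW : IsPoissonPointProcess (volume : Measure ℂ) PW) {ι : Type*} (s : Finset ι)
    {Ev : ι → Set Ω₂} (hEv : ∀ i ∈ s, IsGoodDecreasing (Ev i))
    (hEm : ∀ i ∈ s, MeasurableSet (Ev i)) :
    ∏ i ∈ s, (PB.prod PW).real (Ev i) ≤ (PB.prod PW).real (⋂ i ∈ s, Ev i) := by
  classical
  haveI := hB.isProbabilityMeasure; haveI := hW.isProbabilityMeasure
  induction s using Finset.induction_on with
  | empty => simp
  | insert j s hj ih =>
    rw [Finset.prod_insert hj, Finset.set_biInter_insert]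
    have hEv' : ∀ i ∈ s, IsGoodDecreasing (Ev i) := fun i hi => hEv i (Finset.mem_insert_of_mem hi)
    have hEm' : ∀ i ∈ s, MeasurableSet (Ev i) := fun i hi => hEm i (Finset.mem_insert_of_mem hi)
    have h2 := measureReal_mul_le_of_isGoodDecreasing hB hW (hEv j (Finset.mem_insert_self _ _))
      (isGoodDecreasing_biInter s hEv') (hEm j (Finset.mem_insert_self _ _))
      (Finset.measurableSet_biInter _ hEm')
    exact (mul_le_mul_of_nonneg_left (ih hEv' hEm') measureReal_nonneg).trans h2

end Monotone

/-! ### Transport of crossing events by isometries and by the colour swap -/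

section Transport

/-- A bijective isometry of the plane, applied to both colours, pulls the crossing event of
`(R, A, A')` back to the crossing event of the preimages. [cite: Tassion2016, Remark 2] -/
theorem preimage_pairImage_blackCross {e : ℂ ≃ₜ ℂ} (he : Isometry e) (R A A' : Set ℂ) :
    pairImage e ⁻¹' blackCross R A A' = blackCross (e ⁻¹' R) (e ⁻¹' A) (e ⁻¹' A') := by
  ext ω
  simp only [mem_preimage, blackCross, mem_setOf_eq, coe_pairImage_fst, coe_pairImage_snd]
  constructor
  · rintro ⟨C, hC, hCc, hCp, ⟨x, hxC, hxA⟩, ⟨y, hyC, hyA'⟩⟩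
    refine ⟨e ⁻¹' C, ?_, ?_, ?_, ⟨e.symm x, ?_, ?_⟩, ⟨e.symm y, ?_, ?_⟩⟩
    · intro w hw
      exact ⟨(mem_blackRegion_image_iff he _ _ w).1 (hC hw).1, (hC hw).2⟩
    · rw [← e.image_symm]; exact hCc.image e.symm.continuous
    · rw [← e.image_symm]; exact hCp.image _ e.symm.continuous.continuousOn
    · simpa only [mem_preimage, Homeomorph.apply_symm_apply] using hxC
    · simpa only [mem_preimage, Homeomorph.apply_symm_apply] using hxA
    · simpa only [mem_preimage, Homeomorph.apply_symm_apply] using hyC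
    · simpa only [mem_preimage, Homeomorph.apply_symm_apply] using hyA'
  · rintro ⟨C, hC, hCc, hCp, ⟨x, hxC, hxA⟩, ⟨y, hyC, hyA'⟩⟩
    refine ⟨e '' C, ?_, hCc.image e.continuous, hCp.image _ e.continuous.continuousOn,
      ⟨e x, mem_image_of_mem _ hxC, hxA⟩, ⟨e y, mem_image_of_mem _ hyC, hyA'⟩⟩
    rintro _ ⟨w, hw, rfl⟩
    exact ⟨(mem_blackRegion_image_iff he _ _ w).2 (hC hw).1, (hC hw).2⟩

/-- The same for white crossings. [cite: Tassion2016, Remark 2] -/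
theorem preimage_pairImage_whiteCross {e : ℂ ≃ₜ ℂ} (he : Isometry e) (R A A' : Set ℂ) :
    pairImage e ⁻¹' whiteCross R A A' = whiteCross (e ⁻¹' R) (e ⁻¹' A) (e ⁻¹' A') := by
  have h := preimage_pairImage_blackCross he R A A'
  rw [← preimage_swap_blackCross, ← preimage_swap_blackCross, ← h]
  rfl

variable {PB PW : Measure (PointConfig ℂ)}

/-- **Isometry invariance of crossing probabilities** (real-linear isometries of `ℂ`).
[cite: Tassion2016, Remark 2] -/
theorem measure_blackCross_preimage_linearIsometryEquiv
    (hB : IsPoissonPointProcess (volume : Measure ℂ) PB)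
    (hW : IsPoissonPointProcess (volume : Measure ℂ) PW) (f : ℂ ≃ₗᵢ[ℝ] ℂ) (R A A' : Set ℂ) :
    (PB.prod PW) (blackCross (f ⁻¹' R) (f ⁻¹' A) (f ⁻¹' A')) = (PB.prod PW) (blackCross R A A') := by
  have he : Isometry (f.toHomeomorph : ℂ → ℂ) := f.isometry
  have h := measure_preimage_pairImage_linearIsometryEquiv hB hW f (blackCross R A A')
  rw [preimage_pairImage_blackCross he] at h
  exact h

/-- **Translation invariance of crossing probabilities.** [cite: Tassion2016, Remark 2] -/
theorem measure_blackCross_preimage_addRight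
    (hB : IsPoissonPointProcess (volume : Measure ℂ) PB)
    (hW : IsPoissonPointProcess (volume : Measure ℂ) PW) (v : ℂ) (R A A' : Set ℂ) :
    (PB.prod PW) (blackCross ((· + v) ⁻¹' R) ((· + v) ⁻¹' A) ((· + v) ⁻¹' A')) =
      (PB.prod PW) (blackCross R A A') := by
  have he : Isometry (Homeomorph.addRight v : ℂ → ℂ) := (IsometryEquiv.addRight v).isometry
  have h := measure_preimage_pairImage_addRight hB hW v (blackCross R A A')
  rw [preimage_pairImage_blackCross he] at h
  exact h

/-- **Colour symmetry of crossing probabilities**: a white crossing is as likely as the black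
crossing of the same sets. [cite: Tassion2016, §4] -/
theorem measure_whiteCross_eq (hB : IsPoissonPointProcess (volume : Measure ℂ) PB)
    (hW : IsPoissonPointProcess (volume : Measure ℂ) PW) (R A A' : Set ℂ) :
    (PB.prod PW) (whiteCross R A A') = (PB.prod PW) (blackCross R A A') := by
  rw [← preimage_swap_blackCross]
  exact measure_preimage_swap hB hW _

end Transport

/-! ### Rectangles, their four sides, left–right and top–bottom crossings -/

section Rectangles

/-- The closed axis-parallel rectangle `[a, b] × [c, d]`. [folklore] -/
def cRect (a b c d : ℝ) : Set ℂ := Icc a b ×ℂ Icc c d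

variable {a b c d : ℝ} {PB PW : Measure (PointConfig ℂ)}

/-- Membership in a closed rectangle. [folklore] -/
theorem mem_cRect {z : ℂ} : z ∈ cRect a b c d ↔ (a ≤ z.re ∧ z.re ≤ b) ∧ c ≤ z.im ∧ z.im ≤ d := by
  simp [cRect, mem_reProdIm]

/-- Closed rectangles are compact. [folklore] -/
theorem isCompact_cRect (a b c d : ℝ) : IsCompact (cRect a b c d) :=
  Metric.isCompact_of_isClosed_isBounded (isClosed_Icc.reProdIm isClosed_Icc)
    ((isBounded_Icc a b).reProdIm (isBounded_Icc c d))

/-- Vertical lines are closed. [folklore] -/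
theorem isClosed_setOf_re_eq (a : ℝ) : IsClosed {z : ℂ | z.re = a} :=
  isClosed_eq continuous_re continuous_const

/-- Horizontal lines are closed. [folklore] -/
theorem isClosed_setOf_im_eq (c : ℝ) : IsClosed {z : ℂ | z.im = c} :=
  isClosed_eq continuous_im continuous_const

/-- **Left–right weak-black crossing** of `[a, b] × [c, d]`. [cite: Tassion2016, §1.1] -/
def lrCross (a b c d : ℝ) : Set Ω₂ := blackCross (cRect a b c d) {z | z.re = a} {z | z.re = b}

/-- **Top–bottom weak-black crossing** of `[a, b] × [c, d]`. [cite: Tassion2016, §1.1] -/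
def tbCross (a b c d : ℝ) : Set Ω₂ := blackCross (cRect a b c d) {z | z.im = c} {z | z.im = d}

/-- **Left–right weak-white crossing** of `[a, b] × [c, d]`. [cite: Tassion2016, §1.1] -/
def lrCrossW (a b c d : ℝ) : Set Ω₂ := whiteCross (cRect a b c d) {z | z.re = a} {z | z.re = b}

/-- **Top–bottom weak-white crossing** of `[a, b] × [c, d]`. [cite: Tassion2016, §1.1] -/
def tbCrossW (a b c d : ℝ) : Set Ω₂ := whiteCross (cRect a b c d) {z | z.im = c} {z | z.im = d}

/-- Measurability of the four crossing events. [folklore] -/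
theorem measurableSet_lrCross (a b c d : ℝ) : MeasurableSet (lrCross a b c d) :=
  measurableSet_blackCross (isCompact_cRect a b c d) (isClosed_setOf_re_eq a) (isClosed_setOf_re_eq b)

/-- Measurability of the four crossing events. [folklore] -/
theorem measurableSet_tbCross (a b c d : ℝ) : MeasurableSet (tbCross a b c d) :=
  measurableSet_blackCross (isCompact_cRect a b c d) (isClosed_setOf_im_eq c) (isClosed_setOf_im_eq d)

/-- Measurability of the four crossing events. [folklore] -/
theorem measurableSet_lrCrossW (a b c d : ℝ) : MeasurableSet (lrCrossW a b c d) :=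
  measurableSet_whiteCross (isCompact_cRect a b c d) (isClosed_setOf_re_eq a) (isClosed_setOf_re_eq b)

/-- Measurability of the four crossing events. [folklore] -/
theorem measurableSet_tbCrossW (a b c d : ℝ) : MeasurableSet (tbCrossW a b c d) :=
  measurableSet_whiteCross (isCompact_cRect a b c d) (isClosed_setOf_im_eq c) (isClosed_setOf_im_eq d)

/-- The transposition `x + iy ↦ y + ix` (reflection in the diagonal), a real-linear isometry
exchanging left–right and top–bottom crossings. [folklore] -/
def transposeLIE : ℂ ≃ₗᵢ[ℝ] ℂ where
  toFun z := ⟨z.im, z.re⟩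
  invFun z := ⟨z.im, z.re⟩
  map_add' z w := Complex.ext (by simp) (by simp)
  map_smul' r z := Complex.ext (by simp) (by simp)
  left_inv z := Complex.ext (by simp) (by simp)
  right_inv z := Complex.ext (by simp) (by simp)
  norm_map' z := by
    show ‖(⟨z.im, z.re⟩ : ℂ)‖ = ‖z‖
    rw [norm_eq_sqrt_sq_add_sq, norm_eq_sqrt_sq_add_sq, add_comm]

/-- The transposition swaps the coordinates. [folklore] -/
@[simp] theorem transposeLIE_apply (z : ℂ) : transposeLIE z = ⟨z.im, z.re⟩ := rfl

/-- The transposition maps the rectangle `[c, d] × [a, b]` to `[a, b] × [c, d]`. [folklore] -/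
theorem preimage_transposeLIE_cRect (a b c d : ℝ) :
    transposeLIE ⁻¹' cRect a b c d = cRect c d a b := by
  ext z; simp only [mem_preimage, mem_cRect, transposeLIE_apply]; tauto

/-- **A top–bottom crossing of `[a, b] × [c, d]` is as likely as a left–right crossing of
`[c, d] × [a, b]`** (reflection in the diagonal). [cite: Tassion2016, Remark 2] -/
theorem measure_tbCross_eq (hB : IsPoissonPointProcess (volume : Measure ℂ) PB)
    (hW : IsPoissonPointProcess (volume : Measure ℂ) PW) (a b c d : ℝ) :
    (PB.prod PW) (tbCross a b c d) = (PB.prod PW) (lrCross c d a b) := by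
  have h := measure_blackCross_preimage_linearIsometryEquiv hB hW transposeLIE (cRect c d a b)
    {z | z.re = c} {z | z.re = d}
  rw [preimage_transposeLIE_cRect] at h
  exact h

/-- Translating a rectangle. [folklore] -/
theorem preimage_add_cRect (v : ℂ) (a b c d : ℝ) :
    (· + v) ⁻¹' cRect a b c d = cRect (a - v.re) (b - v.re) (c - v.im) (d - v.im) := by
  ext z
  simp only [mem_preimage, mem_cRect, add_re, add_im]
  constructor
  · rintro ⟨⟨h1, h2⟩, h3, h4⟩; exact ⟨⟨by linarith, by linarith⟩, by linarith, by linarith⟩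
  · rintro ⟨⟨h1, h2⟩, h3, h4⟩; exact ⟨⟨by linarith, by linarith⟩, by linarith, by linarith⟩

/-- Translating a vertical line. [folklore] -/
theorem preimage_add_setOf_re_eq (v : ℂ) (a : ℝ) :
    (· + v) ⁻¹' {z : ℂ | z.re = a} = {z : ℂ | z.re = a - v.re} := by
  ext z; simp only [mem_preimage, mem_setOf_eq, add_re]; constructor <;> intro h <;> linarith

/-- Translating a horizontal line. [folklore] -/
theorem preimage_add_setOf_im_eq (v : ℂ) (c : ℝ) :
    (· + v) ⁻¹' {z : ℂ | z.im = c} = {z : ℂ | z.im = c - v.im} := by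
  ext z; simp only [mem_preimage, mem_setOf_eq, add_im]; constructor <;> intro h <;> linarith

/-- **Translation invariance of left–right crossing probabilities**: only the shape of the
rectangle matters. [cite: Tassion2016, Remark 2] -/
theorem measure_lrCross_eq_of_shape (hB : IsPoissonPointProcess (volume : Measure ℂ) PB)
    (hW : IsPoissonPointProcess (volume : Measure ℂ) PW) {a b c d a' b' c' d' : ℝ}
    (h1 : b' - a' = b - a) (h2 : d' - c' = d - c) :
    (PB.prod PW) (lrCross a' b' c' d') = (PB.prod PW) (lrCross a b c d) := by
  set v : ℂ := ⟨a - a', c - c'⟩ with hv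
  have h := measure_blackCross_preimage_addRight hB hW v (cRect a b c d) {z | z.re = a} {z | z.re = b}
  rw [preimage_add_cRect, preimage_add_setOf_re_eq, preimage_add_setOf_re_eq] at h
  have ha : a - v.re = a' := by simp [hv]
  have hb : b - v.re = b' := by simp [hv]; linarith
  have hc : c - v.im = c' := by simp [hv]
  have hd : d - v.im = d' := by simp [hv]; linarith
  rw [ha, hb, hc, hd] at h
  exact h

/-- **Translation invariance of top–bottom crossing probabilities.** [cite: Tassion2016, Remark 2] -/
theorem measure_tbCross_eq_of_shape (hB : IsPoissonPointProcess (volume : Measure ℂ) PB)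
    (hW : IsPoissonPointProcess (volume : Measure ℂ) PW) {a b c d a' b' c' d' : ℝ}
    (h1 : b' - a' = b - a) (h2 : d' - c' = d - c) :
    (PB.prod PW) (tbCross a' b' c' d') = (PB.prod PW) (tbCross a b c d) := by
  rw [measure_tbCross_eq hB hW, measure_tbCross_eq hB hW]
  exact measure_lrCross_eq_of_shape hB hW h2 h1

/-- White crossings are as likely as black ones. [cite: Tassion2016, §4] -/
theorem measure_lrCrossW_eq (hB : IsPoissonPointProcess (volume : Measure ℂ) PB)
    (hW : IsPoissonPointProcess (volume : Measure ℂ) PW) (a b c d : ℝ) :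
    (PB.prod PW) (lrCrossW a b c d) = (PB.prod PW) (lrCross a b c d) :=
  measure_whiteCross_eq hB hW _ _ _

/-- White crossings are as likely as black ones. [cite: Tassion2016, §4] -/
theorem measure_tbCrossW_eq (hB : IsPoissonPointProcess (volume : Measure ℂ) PB)
    (hW : IsPoissonPointProcess (volume : Measure ℂ) PW) (a b c d : ℝ) :
    (PB.prod PW) (tbCrossW a b c d) = (PB.prod PW) (tbCross a b c d) :=
  measure_whiteCross_eq hB hW _ _ _

end Rectangles

/-! ### Duality: weak-black left–right or weak-white top–bottom -/

section Duality

variable {a b c d : ℝ}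

/-- **Planar duality for weak colourings.**  In every configuration and every rectangle
(`a < b`, `c < d`) there is a weak-black left–right continuum crossing or a weak-white top–bottom
continuum crossing: if no connected set of black points joins the vertical sides, the dual path of
`exists_path_avoiding_of_not_crossed` joins the horizontal sides through non-black, hence white,
points. (Both may occur: ties are both colours.) [cite: Tassion2016, §4 ("by duality")] -/
theorem mem_lrCross_or_mem_tbCrossW (hab : a < b) (hcd : c < d) (ω : Ω₂) :
    ω ∈ lrCross a b c d ∨ ω ∈ tbCrossW a b c d := by
  by_cases h : ω ∈ lrCross a b c d
  · exact Or.inl h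
  right
  set Bk : Set ℂ := ((ω.1 : PointConfig ℂ) : Set ℂ) with hBk
  set Wh : Set ℂ := ((ω.2 : PointConfig ℂ) : Set ℂ) with hWh
  set 𝒦 : Set ℂ := blackRegion Bk Wh ∩ cRect a b c d with h𝒦
  have h𝒦c : IsCompact 𝒦 := (isCompact_cRect a b c d).inter_left (isClosed_blackRegion _ _)
  have hno : ∀ C ⊆ 𝒦, IsPreconnected C → (∃ z ∈ C, z.re = a) → (∃ z ∈ C, z.re = b) → False := by
    intro C hC hCp ⟨x, hx, hxa⟩ ⟨y, hy, hyb⟩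
    have hcl : closure C ⊆ 𝒦 := closure_minimal hC h𝒦c.isClosed
    exact h ⟨closure C, hcl, h𝒦c.of_isClosed_subset isClosed_closure hcl, hCp.closure,
      ⟨x, subset_closure hx, hxa⟩, ⟨y, subset_closure hy, hyb⟩⟩
  obtain ⟨γ, hγc, hγR, hγ0, hγ1, hγK⟩ :=
    exists_path_avoiding_of_not_crossed hab hcd h𝒦c inter_subset_right hno
  refine ⟨γ '' Icc 0 1, ?_, isCompact_Icc.image_of_continuousOn hγc,
    isPreconnected_Icc.image _ hγc, ⟨γ 0, mem_image_of_mem _ ⟨le_rfl, zero_le_one⟩, hγ0⟩,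
    ⟨γ 1, mem_image_of_mem _ ⟨zero_le_one, le_rfl⟩, hγ1⟩⟩
  rintro _ ⟨t, ht, rfl⟩
  refine ⟨?_, hγR ht⟩
  have h1 : γ t ∉ blackRegion Bk Wh := fun hh => hγK t ht ⟨hh, hγR ht⟩
  rw [mem_blackRegion, not_le] at h1
  exact h1.le

variable {PB PW : Measure (PointConfig ℂ)}

/-- **`P[lrCross] + P[tbCrossW] ≥ 1`.** [cite: Tassion2016, §4] -/
theorem one_le_measureReal_lrCross_add (hB : IsPoissonPointProcess (volume : Measure ℂ) PB)
    (hW : IsPoissonPointProcess (volume : Measure ℂ) PW) (hab : a < b) (hcd : c < d) :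
    1 ≤ (PB.prod PW).real (lrCross a b c d) + (PB.prod PW).real (tbCrossW a b c d) := by
  haveI := hB.isProbabilityMeasure; haveI := hW.isProbabilityMeasure
  have huniv : (lrCross a b c d ∪ tbCrossW a b c d : Set Ω₂) = univ :=
    eq_univ_of_forall fun ω => mem_lrCross_or_mem_tbCrossW hab hcd ω
  calc (1 : ℝ) = (PB.prod PW).real (lrCross a b c d ∪ tbCrossW a b c d) := by
        rw [huniv, probReal_univ]
    _ ≤ _ := measureReal_union_le _ _

/-- **The square crossing bound `c₀ = 1/2`** (Tassion 2016, eq. (5) at `p = 1/2`): a weak-black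
left–right continuum crossing of a square has probability at least `1/2`, at every scale and
position. [cite: Tassion2016, §1.3 eq. (5) and §4] -/
theorem half_le_measureReal_lrCross_square (hB : IsPoissonPointProcess (volume : Measure ℂ) PB)
    (hW : IsPoissonPointProcess (volume : Measure ℂ) PW) {a b c d : ℝ} (hab : a < b)
    (hsq : d - c = b - a) : 1 / 2 ≤ (PB.prod PW).real (lrCross a b c d) := by
  have hcd : c < d := by linarith
  have h1 := one_le_measureReal_lrCross_add hB hW hab hcd
  have h2 : (PB.prod PW).real (tbCrossW a b c d) = (PB.prod PW).real (lrCross a b c d) := by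
    rw [measureReal_def, measureReal_def, measure_tbCrossW_eq hB hW, measure_tbCross_eq hB hW,
      measure_lrCross_eq_of_shape hB hW hsq.symm hsq]
  linarith

end Duality

/-! ### Blocking: white long crossings of the box annulus exclude strict annulus crossings -/

section Blocking

variable {z : ℂ} {u : ℝ}

/-- The four weak-white long crossings of the rectangles of the box annulus
`A^box(5u/4, 5u/2)` around `z` (top and bottom: left–right; left and right: top–bottom).
[cite: Tassion2016, §4] -/
def whiteBoxCircuit (z : ℂ) (u : ℝ) : Set Ω₂ :=
  lrCrossW (z.re - 5 / 2 * u) (z.re + 5 / 2 * u) (z.im + 5 / 4 * u) (z.im + 5 / 2 * u) ∩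
  lrCrossW (z.re - 5 / 2 * u) (z.re + 5 / 2 * u) (z.im - 5 / 2 * u) (z.im - 5 / 4 * u) ∩
  tbCrossW (z.re - 5 / 2 * u) (z.re - 5 / 4 * u) (z.im - 5 / 2 * u) (z.im + 5 / 2 * u) ∩
  tbCrossW (z.re + 5 / 4 * u) (z.re + 5 / 2 * u) (z.im - 5 / 2 * u) (z.im + 5 / 2 * u)

/-- The white box circuit event is measurable. [folklore] -/
theorem measurableSet_whiteBoxCircuit (z : ℂ) (u : ℝ) : MeasurableSet (whiteBoxCircuit z u) :=
  (((measurableSet_lrCrossW _ _ _ _).inter (measurableSet_lrCrossW _ _ _ _)).inter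
    (measurableSet_tbCrossW _ _ _ _)).inter (measurableSet_tbCrossW _ _ _ _)

/-- A white continuum misses the strictly black region. [cite: Tassion2016, §1.1] -/
theorem not_mem_strictBlackRegion_of_mem_white {Bk Wh C : Set ℂ} {w : ℂ}
    (hC : C ⊆ blackRegion Wh Bk) (hw : w ∈ C) : w ∉ strictBlackRegion Bk Wh := by
  have h := hC hw
  rw [← compl_strictBlackRegion] at h
  exact h

/-- **Blocking lemma.**  If the four rectangles of the box annulus `A^box(5u/4, 5u/2)` around `z`
have weak-white long continuum crossings, there is no strictly black path from the disc
`|a - z| < 5u/4` to `|b - z| > 15u/4`: the path leaves the box `‖· - z‖_∞ ≤ 5u/2` through one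
of its sides, and its piece from the last level `5u/4` to that side is in plus position with the
white crossing of the corresponding rectangle (`inter_nonempty_of_plus`), while strictly black and
weakly white points are disjoint. [cite: Tassion2016, §4] -/
theorem not_mem_strictAnnulusCrossing_of_mem_whiteBoxCircuit (hu : 0 < u) {ω : Ω₂}
    (hω : ω ∈ whiteBoxCircuit z u) : ω ∉ strictAnnulusCrossing z u := by
  obtain ⟨⟨⟨hT, hBo⟩, hL⟩, hR⟩ := hω
  rintro ⟨a, ha, b, hb, γ, hγ⟩
  set r₁ : ℝ := 5 / 4 * u with hr₁
  set r₂ : ℝ := 5 / 2 * u with hr₂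
  have hr₁₂ : r₁ < r₂ := by rw [hr₁, hr₂]; linarith
  -- the sup-norm distance to `z` along the path
  set p : ℝ → ℂ := fun t => γ.extend t with hp
  have hpc : Continuous p := γ.continuous_extend
  set φ : ℝ → ℝ := fun t => max |(p t).re - z.re| |(p t).im - z.im| with hφ
  have hφc : Continuous φ := by
    refine Continuous.max ?_ ?_
    · exact (continuous_abs.comp ((continuous_re.comp hpc).sub continuous_const))
    · exact (continuous_abs.comp ((continuous_im.comp hpc).sub continuous_const))
  have hφ0 : φ 0 ≤ r₁ := by
    have h0 : p 0 = a := by simp [hp]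
    have ha' : dist a z < r₁ := mem_ball.1 ha
    rw [dist_eq_norm] at ha'
    simp only [hφ, h0]
    refine max_le ?_ ?_
    · exact ((abs_re_le_norm (a - z)).trans ha'.le).trans_eq' (by simp)
    · exact ((abs_im_le_norm (a - z)).trans ha'.le).trans_eq' (by simp)
  have hφ1 : r₂ ≤ φ 1 := by
    have h1 : p 1 = b := by simp [hp]
    have hb' : 15 / 4 * u < dist b z := by simpa [mem_closedBall, not_le] using hb
    rw [dist_eq_norm] at hb'
    simp only [hφ, h1]
    by_contra hlt
    rw [not_le, max_lt_iff] at hlt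
    have hre : |(b - z).re| < r₂ := by simpa using hlt.1
    have him : |(b - z).im| < r₂ := by simpa using hlt.2
    have hn : ‖b - z‖ ^ 2 = (b - z).re ^ 2 + (b - z).im ^ 2 := by
      rw [Complex.sq_norm, Complex.normSq_apply]; ring
    have h2 : (b - z).re ^ 2 < r₂ ^ 2 := by
      have := abs_lt.1 hre; nlinarith
    have h3 : (b - z).im ^ 2 < r₂ ^ 2 := by
      have := abs_lt.1 him; nlinarith
    have h4 : (15 / 4 * u) ^ 2 < ‖b - z‖ ^ 2 := by
      have h15 : (0 : ℝ) ≤ 15 / 4 * u := by positivity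
      nlinarith [norm_nonneg (b - z)]
    rw [hr₂] at h2 h3
    nlinarith
  -- the piece of the path between the levels `r₁` and `r₂` of `φ`
  set g : ℝ → ℂ := fun t => ((-φ t : ℝ) : ℂ) * I with hg
  have hgc : Continuous g := (continuous_ofReal.comp hφc.neg).mul continuous_const
  have hgim : ∀ t, (g t).im = -φ t := fun t => by simp [hg]
  obtain ⟨t₁, t₂, ht₁, ht₁₂, ht₂, hgt₁, hgt₂, hband⟩ :=
    exists_subpath_crossing_levels hgc (neg_lt_neg hr₁₂) (by rw [hgim]; linarith)
      (by rw [hgim]; linarith)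
  rw [hgim] at hgt₁ hgt₂
  have hφt₁ : φ t₁ = r₁ := by linarith
  have hφt₂ : φ t₂ = r₂ := by linarith
  have hφle : ∀ t, t₁ ≤ t → t ≤ t₂ → φ t ≤ r₂ := fun t h1 h2 => by
    have := (hband t h1 h2).1; rw [hgim] at this; linarith
  -- the piece `V = p [t₁, t₂]` is a strictly black continuum
  set V : Set ℂ := p '' Icc t₁ t₂ with hV
  have hVc : IsCompact V := isCompact_Icc.image hpc
  have hVp : IsPreconnected V := isPreconnected_Icc.image _ hpc.continuousOn
  have hVS : V ⊆ 𝐒 ω := by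
    rintro _ ⟨t, ⟨h1, h2⟩, rfl⟩
    have ht01 : t ∈ Icc (0 : ℝ) 1 := ⟨ht₁.trans h1, h2.trans ht₂⟩
    have : p t = γ ⟨t, ht01⟩ := by simp [hp, Path.extend_apply _ ht01]
    rw [this]
    exact (hγ ⟨t, ht01⟩).1
  have hVre : ∀ w ∈ V, z.re - r₂ ≤ w.re ∧ w.re ≤ z.re + r₂ := by
    rintro _ ⟨t, ⟨h1, h2⟩, rfl⟩
    have h := (le_max_left _ _).trans (hφle t h1 h2)
    constructor <;> linarith [(abs_le.1 h).1, (abs_le.1 h).2]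
  have hVim : ∀ w ∈ V, z.im - r₂ ≤ w.im ∧ w.im ≤ z.im + r₂ := by
    rintro _ ⟨t, ⟨h1, h2⟩, rfl⟩
    have h := (le_max_right _ _).trans (hφle t h1 h2)
    constructor <;> linarith [(abs_le.1 h).1, (abs_le.1 h).2]
  have hp₁V : p t₁ ∈ V := mem_image_of_mem _ ⟨le_rfl, ht₁₂.le⟩
  have hp₂V : p t₂ ∈ V := mem_image_of_mem _ ⟨ht₁₂.le, le_rfl⟩
  have hp₁re : |(p t₁).re - z.re| ≤ r₁ := (le_max_left _ _).trans hφt₁.le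
  have hp₁im : |(p t₁).im - z.im| ≤ r₁ := (le_max_right _ _).trans hφt₁.le
  -- no common point with a white continuum
  have hdisj : ∀ {C : Set ℂ}, C ⊆ blackRegion ((ω.2 : PointConfig ℂ) : Set ℂ)
      ((ω.1 : PointConfig ℂ) : Set ℂ) → (V ∩ C).Nonempty → False := by
    intro C hC ⟨w, hwV, hwC⟩
    exact not_mem_strictBlackRegion_of_mem_white hC hwC (hVS hwV)
  -- which side does the path leave through?
  have hexit : |(p t₂).re - z.re| = r₂ ∨ |(p t₂).im - z.im| = r₂ := by
    rcases max_choice |(p t₂).re - z.re| |(p t₂).im - z.im| with h | h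
    · exact Or.inl (h ▸ hφt₂)
    · exact Or.inr (h ▸ hφt₂)
  have hr₂nn : 0 ≤ r₂ := by positivity
  rcases hexit with hre | him
  · rcases (abs_eq hr₂nn).1 hre with h | h
    · -- right rectangle
      obtain ⟨C, hC, hCc, hCp, ⟨x, hxC, hx⟩, ⟨y, hyC, hy⟩⟩ := hR
      refine hdisj (hC.trans inter_subset_left) ?_
      have := inter_nonempty_of_plus (V := C) (H := V) (a := z.re + 5 / 4 * u) (b := z.re + 5 / 2 * u)
        (c := z.im - 5 / 2 * u) (d := z.im + 5 / 2 * u) (by linarith) (by linarith) hCc hCp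
        (fun w hw => (mem_cRect.1 (hC hw).2).1) ⟨x, hxC, le_of_eq hx⟩ ⟨y, hyC, ge_of_eq hy⟩
        hVc hVp (fun w hw => by have := hVim w hw; rw [hr₂] at this; exact this)
        ⟨p t₁, hp₁V, by rw [hr₁] at hp₁re; linarith [(abs_le.1 hp₁re).2]⟩
        ⟨p t₂, hp₂V, by rw [hr₂] at h; linarith⟩
      rwa [inter_comm] at this
    · -- left rectangle
      obtain ⟨C, hC, hCc, hCp, ⟨x, hxC, hx⟩, ⟨y, hyC, hy⟩⟩ := hL
      refine hdisj (hC.trans inter_subset_left) ?_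
      have := inter_nonempty_of_plus (V := C) (H := V) (a := z.re - 5 / 2 * u) (b := z.re - 5 / 4 * u)
        (c := z.im - 5 / 2 * u) (d := z.im + 5 / 2 * u) (by linarith) (by linarith) hCc hCp
        (fun w hw => (mem_cRect.1 (hC hw).2).1) ⟨x, hxC, le_of_eq hx⟩ ⟨y, hyC, ge_of_eq hy⟩
        hVc hVp (fun w hw => by have := hVim w hw; rw [hr₂] at this; exact this)
        ⟨p t₂, hp₂V, by rw [hr₂] at h; linarith⟩
        ⟨p t₁, hp₁V, by rw [hr₁] at hp₁re; linarith [(abs_le.1 hp₁re).1]⟩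
      rwa [inter_comm] at this
  · rcases (abs_eq hr₂nn).1 him with h | h
    · -- top rectangle
      obtain ⟨C, hC, hCc, hCp, ⟨x, hxC, hx⟩, ⟨y, hyC, hy⟩⟩ := hT
      refine hdisj (hC.trans inter_subset_left) ?_
      exact inter_nonempty_of_plus (V := V) (H := C) (a := z.re - 5 / 2 * u) (b := z.re + 5 / 2 * u)
        (c := z.im + 5 / 4 * u) (d := z.im + 5 / 2 * u) (by linarith) (by linarith) hVc hVp
        (fun w hw => by have := hVre w hw; rw [hr₂] at this; exact this)
        ⟨p t₁, hp₁V, by rw [hr₁] at hp₁im; linarith [(abs_le.1 hp₁im).2]⟩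
        ⟨p t₂, hp₂V, by rw [hr₂] at h; linarith⟩
        hCc hCp (fun w hw => (mem_cRect.1 (hC hw).2).2) ⟨x, hxC, le_of_eq hx⟩ ⟨y, hyC, ge_of_eq hy⟩
    · -- bottom rectangle
      obtain ⟨C, hC, hCc, hCp, ⟨x, hxC, hx⟩, ⟨y, hyC, hy⟩⟩ := hBo
      refine hdisj (hC.trans inter_subset_left) ?_
      exact inter_nonempty_of_plus (V := V) (H := C) (a := z.re - 5 / 2 * u) (b := z.re + 5 / 2 * u)
        (c := z.im - 5 / 2 * u) (d := z.im - 5 / 4 * u) (by linarith) (by linarith) hVc hVp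
        (fun w hw => by have := hVre w hw; rw [hr₂] at this; exact this)
        ⟨p t₂, hp₂V, by rw [hr₂] at h; linarith⟩
        ⟨p t₁, hp₁V, by rw [hr₁] at hp₁im; linarith [(abs_le.1 hp₁im).1]⟩
        hCc hCp (fun w hw => (mem_cRect.1 (hC hw).2).2) ⟨x, hxC, le_of_eq hx⟩ ⟨y, hyC, ge_of_eq hy⟩

end Blocking

/-! ### The annulus bound from white box circuits, and from weak-black RSW -/

section AnnulusBound

variable {PB PW : Measure (PointConfig ℂ)}

/-- The white box circuit event is good-decreasing. [folklore] -/
theorem isGoodDecreasing_whiteBoxCircuit (z : ℂ) (u : ℝ) : IsGoodDecreasing (whiteBoxCircuit z u) :=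
  (((isGoodDecreasing_whiteCross _ _ _).inter (isGoodDecreasing_whiteCross _ _ _)).inter
    (isGoodDecreasing_whiteCross _ _ _)).inter (isGoodDecreasing_whiteCross _ _ _)

/-- **Strict annulus crossings are unlikely when long crossings are likely.**  If weak-black
left–right crossings of `5u × 5u/4` rectangles have probability at least `c₁ ≥ 0`, then
`P[strictAnnulusCrossing z u] ≤ 1 - c₁ ^ 4` (colour swap, isometry invariance, FKG for the four
white crossings, and the blocking lemma). [cite: Tassion2016, §4] -/
theorem measureReal_strictAnnulusCrossing_le (hB : IsPoissonPointProcess (volume : Measure ℂ) PB)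
    (hW : IsPoissonPointProcess (volume : Measure ℂ) PW) {u c₁ : ℝ} (hu : 0 < u) (hc₁ : 0 ≤ c₁)
    (h : c₁ ≤ (PB.prod PW).real (lrCross 0 (5 * u) 0 (5 / 4 * u))) (z : ℂ) :
    (PB.prod PW).real (strictAnnulusCrossing z u) ≤ 1 - c₁ ^ 4 := by
  haveI := hB.isProbabilityMeasure; haveI := hW.isProbabilityMeasure
  set μ := PB.prod PW with hμ
  -- the four white crossings each have probability `≥ c₁`
  set W₁ := lrCrossW (z.re - 5 / 2 * u) (z.re + 5 / 2 * u) (z.im + 5 / 4 * u) (z.im + 5 / 2 * u)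
  set W₂ := lrCrossW (z.re - 5 / 2 * u) (z.re + 5 / 2 * u) (z.im - 5 / 2 * u) (z.im - 5 / 4 * u)
  set W₃ := tbCrossW (z.re - 5 / 2 * u) (z.re - 5 / 4 * u) (z.im - 5 / 2 * u) (z.im + 5 / 2 * u)
  set W₄ := tbCrossW (z.re + 5 / 4 * u) (z.re + 5 / 2 * u) (z.im - 5 / 2 * u) (z.im + 5 / 2 * u)
  have h₁ : c₁ ≤ μ.real W₁ := by
    refine h.trans_eq ?_
    rw [measureReal_def, measureReal_def, measure_lrCrossW_eq hB hW]
    exact congrArg ENNReal.toReal (measure_lrCross_eq_of_shape hB hW (a := 0) (b := 5 * u) (c := 0)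
      (d := 5 / 4 * u) (a' := z.re - 5 / 2 * u) (b' := z.re + 5 / 2 * u) (c' := z.im + 5 / 4 * u)
      (d' := z.im + 5 / 2 * u) (by ring) (by ring)).symm
  have h₂ : c₁ ≤ μ.real W₂ := by
    refine h.trans_eq ?_
    rw [measureReal_def, measureReal_def, measure_lrCrossW_eq hB hW]
    exact congrArg ENNReal.toReal (measure_lrCross_eq_of_shape hB hW (a := 0) (b := 5 * u) (c := 0)
      (d := 5 / 4 * u) (a' := z.re - 5 / 2 * u) (b' := z.re + 5 / 2 * u) (c' := z.im - 5 / 2 * u)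
      (d' := z.im - 5 / 4 * u) (by ring) (by ring)).symm
  have h₃ : c₁ ≤ μ.real W₃ := by
    refine h.trans_eq ?_
    rw [measureReal_def, measureReal_def, measure_tbCrossW_eq hB hW, measure_tbCross_eq hB hW]
    exact congrArg ENNReal.toReal (measure_lrCross_eq_of_shape hB hW (a := 0) (b := 5 * u) (c := 0)
      (d := 5 / 4 * u) (a' := z.im - 5 / 2 * u) (b' := z.im + 5 / 2 * u) (c' := z.re - 5 / 2 * u)
      (d' := z.re - 5 / 4 * u) (by ring) (by ring)).symm
  have h₄ : c₁ ≤ μ.real W₄ := by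
    refine h.trans_eq ?_
    rw [measureReal_def, measureReal_def, measure_tbCrossW_eq hB hW, measure_tbCross_eq hB hW]
    exact congrArg ENNReal.toReal (measure_lrCross_eq_of_shape hB hW (a := 0) (b := 5 * u) (c := 0)
      (d := 5 / 4 * u) (a' := z.im - 5 / 2 * u) (b' := z.im + 5 / 2 * u) (c' := z.re + 5 / 4 * u)
      (d' := z.re + 5 / 2 * u) (by ring) (by ring)).symm
  -- FKG
  have hm₁ : MeasurableSet W₁ := measurableSet_lrCrossW _ _ _ _
  have hm₂ : MeasurableSet W₂ := measurableSet_lrCrossW _ _ _ _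
  have hm₃ : MeasurableSet W₃ := measurableSet_tbCrossW _ _ _ _
  have hm₄ : MeasurableSet W₄ := measurableSet_tbCrossW _ _ _ _
  have hd₁ : IsGoodDecreasing W₁ := isGoodDecreasing_whiteCross _ _ _
  have hd₂ : IsGoodDecreasing W₂ := isGoodDecreasing_whiteCross _ _ _
  have hd₃ : IsGoodDecreasing W₃ := isGoodDecreasing_whiteCross _ _ _
  have hd₄ : IsGoodDecreasing W₄ := isGoodDecreasing_whiteCross _ _ _
  have hf12 := measureReal_mul_le_of_isGoodDecreasing hB hW hd₁ hd₂ hm₁ hm₂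
  have hf123 := measureReal_mul_le_of_isGoodDecreasing hB hW (hd₁.inter hd₂) hd₃ (hm₁.inter hm₂) hm₃
  have hf1234 := measureReal_mul_le_of_isGoodDecreasing hB hW ((hd₁.inter hd₂).inter hd₃) hd₄
    ((hm₁.inter hm₂).inter hm₃) hm₄
  have hprod : c₁ ^ 4 ≤ μ.real (whiteBoxCircuit z u) := by
    have e1 : c₁ ^ 2 ≤ μ.real (W₁ ∩ W₂) := by
      nlinarith [mul_le_mul h₁ h₂ hc₁ measureReal_nonneg]
    have e2 : c₁ ^ 3 ≤ μ.real (W₁ ∩ W₂ ∩ W₃) := by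
      nlinarith [mul_le_mul e1 h₃ hc₁ measureReal_nonneg]
    have e3 : c₁ ^ 4 ≤ μ.real (W₁ ∩ W₂ ∩ W₃ ∩ W₄) := by
      nlinarith [mul_le_mul e2 h₄ hc₁ measureReal_nonneg]
    exact e3
  -- blocking
  have hsub : strictAnnulusCrossing z u ⊆ (whiteBoxCircuit z u)ᶜ := fun ω hω hω' =>
    not_mem_strictAnnulusCrossing_of_mem_whiteBoxCircuit hu hω' hω
  calc μ.real (strictAnnulusCrossing z u) ≤ μ.real (whiteBoxCircuit z u)ᶜ :=
        measureReal_mono hsub (measure_ne_top _ _)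
    _ = 1 - μ.real (whiteBoxCircuit z u) := probReal_compl_eq_one_sub (measurableSet_whiteBoxCircuit z u)
    _ ≤ 1 - c₁ ^ 4 := by linarith

/-- **`VoronoiAnnealedOneArm` from weak-black RSW.**  If for every pair of independent Poisson
processes of Lebesgue intensity the weak-black left–right continuum crossings of the rectangles
`[0, 4s] × [0, s]` have probability at least `c₁ > 0` at all large scales `s ≥ s₀` (Tassion's
Theorem 1 with `ρ = 4` at `p = 1/2`, continuum form), then the annealed one-arm bound
`VoronoiAnnealedOneArm` holds. [cite: Tassion2016, Thm 1 and §4 (proof of Thm 3 (2))] -/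
theorem VoronoiAnnealedOneArm_of_weakRSW
    (hRSW : ∀ (PB PW : Measure (PointConfig ℂ)), IsPoissonPointProcess (volume : Measure ℂ) PB →
      IsPoissonPointProcess (volume : Measure ℂ) PW → ∃ c₁ s₀ : ℝ, 0 < c₁ ∧ 0 < s₀ ∧
        ∀ s, s₀ ≤ s → c₁ ≤ (PB.prod PW).real (lrCross 0 (4 * s) 0 s)) :
    VoronoiAnnealedOneArm := by
  refine VoronoiAnnealedOneArm_of_annulusBound fun PB PW hB hW => ?_
  obtain ⟨c₁, s₀, hc₁, hs₀, h⟩ := hRSW PB PW hB hW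
  have hc₁1 : c₁ ≤ 1 := by
    haveI := hB.isProbabilityMeasure; haveI := hW.isProbabilityMeasure
    exact (h s₀ le_rfl).trans measureReal_le_one
  refine ⟨c₁ ^ 4, s₀, by positivity, hs₀, fun u hu z => ?_⟩
  have hu0 : 0 < u := hs₀.trans_le hu
  have hs : s₀ ≤ 5 / 4 * u := by linarith
  have h' : c₁ ≤ (PB.prod PW).real (lrCross 0 (5 * u) 0 (5 / 4 * u)) := by
    have := h (5 / 4 * u) hs
    rwa [show 4 * (5 / 4 * u) = 5 * u by ring] at this
  exact measureReal_strictAnnulusCrossing_le hB hW hu0 hc₁.le h' z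

end AnnulusBound

end Literature.Probability.Percolation
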